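import Summits.ValiantsHypothesis.ValiantsHypothesis.Theses.GirthSidon
import Summits.ValiantsHypothesis.ValiantsHypothesis.Theorems.GirthSidonToricSwallowForcesShortRelationMoore
import Summits.ValiantsHypothesis.ValiantsHypothesis.Theorems.GirthSidonToricSwallowForcesShortRelationCore

/-!
# GirthSidon / ToricSwallowForcesShortRelation — proof

Closes item `stmt-ValiantsHypothesis-6538` of route GirthSidon (problem `ValiantsHypothesis`):
`Summit.ValiantsHypothesis.ValiantsHypothesis.Theses.GirthSidon.ToricSwallowForcesShortRelation`,
the toric ("provable") half of the route's cancellation crux.  For `m ≥ 6^10 + 1`, `s^10 ≤ m^9`,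
exponents `d : Fin m → ℕ` and a map `Γ : ℂ^s → ℂ^m` whose coordinates are monomials
`c_i · y^{e_i}` of degree `≤ 2`: if the image of the curve `x ↦ (x^{d_i})_i` lies in the image of
`Γ`, then two distinct multisets `S ≠ T` over `Fin m` of sizes `≤ 30` have `Σ_S d = Σ_T d`.

Proof.
* Transfer (`sum_map_eq_of_swallow`): swallowing at `x = 1` and `x = 2` turns every relation
  `Σ_S e = Σ_T e` among the exponent vectors into `2^{Σ_S d} = 2^{Σ_T d}`.
* Degenerate coordinates: `c_i = 0` is impossible (`x = 1`), and `e_i = 0` forces `d_i = 0`,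
  whence the relation `{i} ≠ 0`.
* Combinatorics (`exists_short_relation`, on the endpoint multisets `verts i = toMultiset (e i)`
  of sizes `1` or `2`): a repeated `verts` is a relation of length `1`; otherwise at most `2s`
  indices are loops/singletons (`card_filter_not_edge_le`), the remaining `> (q+2)·s` genuine
  edges have a core of minimum degree `≥ q + 2` (`exists_core`), and the relation-valued Moore
  bound (`pow_le_card_of_noRel`, `k = 30`) gives `q^30 ≤ s`, contradicting the choice of `q`.
* Arithmetic (`exists_root_param`): from `s^10 ≤ m^9` and `m > 6^10` there is `q` with
  `s < q^30` and `(q + 4)·s < m`.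
The constant `30` is the planner's; the argument needs far less.  No named facts are used.
-/

set_option linter.dupNamespace false -- single-conjunct summit: `ValiantsHypothesis.ValiantsHypothesis`

namespace Summit.ValiantsHypothesis.ValiantsHypothesis.Theorems.GirthSidonToric

open Finset

/-- **Short relations among few small multisets.** If `verts : ι → Multiset V` takes nonempty
values of size `≤ 2`, `|V| < q^30` and `|ι| > (q + 4)·|V|`, then two distinct multisets
`S ≠ T` over `ι`, each of size `≤ 30`, have the same union `(S.map verts).sum = (T.map verts).sum`.
[folklore] -/
theorem exists_short_relation {V ι : Type*} [DecidableEq V] [Fintype V] [DecidableEq ι] [Fintype ι]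
    (verts : ι → Multiset V) (h1 : ∀ i, verts i ≠ 0) (h2 : ∀ i, Multiset.card (verts i) ≤ 2)
    {q : ℕ} (hq : Fintype.card V < q ^ 30) (hm : (q + 4) * Fintype.card V < Fintype.card ι) :
    ∃ S T : Multiset ι, S ≠ T ∧ Multiset.card S ≤ 30 ∧ Multiset.card T ≤ 30 ∧
      (S.map verts).sum = (T.map verts).sum := by
  by_contra hcon
  have hnorel : ∀ S T : Multiset ι, Multiset.card S ≤ 30 → Multiset.card T ≤ 30 →
      (S.map verts).sum = (T.map verts).sum → S = T := by
    intro S T hS hT h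
    by_contra hne
    exact hcon ⟨S, T, hne, hS, hT, h⟩
  have hinj : Function.Injective verts := by
    intro i j h
    have := hnorel {i} {j} (by simp) (by simp) (by simpa using h)
    exact Multiset.singleton_inj.1 this
  -- the genuine edges
  set A : Finset ι := univ.filter fun i => Multiset.card (verts i) = 2 ∧ (verts i).Nodup with hAdef
  have hAcard : (q + 2) * Fintype.card V < A.card := by
    have h := Finset.card_filter_add_card_filter_not (s := (univ : Finset ι))
      (fun i => Multiset.card (verts i) = 2 ∧ (verts i).Nodup)
    have h' := card_filter_not_edge_le verts hinj h1 h2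
    rw [card_univ] at h
    rw [hAdef]
    nlinarith
  -- a core of minimum degree `≥ q + 2`
  obtain ⟨W, hWne, hWdeg⟩ := exists_core A verts (fun i _ => h1 i) (q + 2) hAcard
  set A' : Finset ι := A.filter fun i => ∀ u ∈ verts i, u ∈ W with hA'def
  have hA'nd : ∀ i ∈ A', (verts i).Nodup := fun i hi =>
    (mem_filter.1 (mem_filter.1 hi).1).2.2
  have hA'pair : ∀ i ∈ A', ∃ a ∈ W, ∃ b ∈ W, a ≠ b ∧ verts i = {a, b} := by
    intro i hi
    obtain ⟨hiA, hiW⟩ := mem_filter.1 hi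
    obtain ⟨-, hc2, hnd⟩ := mem_filter.1 hiA
    obtain ⟨a, b, hab⟩ := Multiset.card_eq_two.1 hc2
    rw [hab] at hiW hnd
    refine ⟨a, hiW a (by simp), b, hiW b (by simp), nodup_pair_iff.1 hnd, hab⟩
  have hdeg : ∀ v ∈ W, q + 2 ≤ (W.filter fun x => ∃ i ∈ A', verts i = {v, x}).card :=
    fun v hv => (hWdeg v hv).trans
      (card_filter_mem_le_card_nbrs A' verts W (hinj.injOn) hA'pair v)
  have hbound := pow_le_card_of_noRel (V := V) (A := A') (verts := verts) (W := W) hA'nd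
    (k := 30) (c := q + 2) (fun S T _ _ hS hT h => hnorel S T hS hT h) hdeg hWne
  have hWle : W.card ≤ Fintype.card V := card_le_univ W
  rw [Nat.add_sub_cancel] at hbound
  omega

/-- **Transfer.** If for every `x : ℂ` the point `(x^{d_i})_i` is of the form
`(c_i · y^{e_i})_i`, then every relation `Σ_S e = Σ_T e` among the exponent vectors yields
`Σ_S d = Σ_T d` (evaluate at `x = 1` to compare the constants, then at `x = 2`). [folklore] -/
theorem sum_map_eq_of_swallow {s m : ℕ} (d : Fin m → ℕ) (e : Fin m → (Fin s →₀ ℕ))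
    (c : Fin m → ℂ)
    (hsw : ∀ x : ℂ, ∃ y : Fin s → ℂ, ∀ i, c i * (e i).prod (fun n k => y n ^ k) = x ^ d i)
    {S T : Multiset (Fin m)} (h : (S.map e).sum = (T.map e).sum) :
    (S.map d).sum = (T.map d).sum := by
  -- multiplicativity of monomial evaluation along multisets
  have hmono : ∀ (y : Fin s → ℂ) (U : Multiset (Fin m)),
      (U.map fun i => c i * (e i).prod (fun n k => y n ^ k)).prod =
        (U.map c).prod * (U.map e).sum.prod (fun n k => y n ^ k) := by
    intro y U
    induction U using Multiset.induction_on with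
    | empty => simp
    | cons a U ih =>
      rw [Multiset.map_cons, Multiset.prod_cons, ih, Multiset.map_cons, Multiset.prod_cons,
        Multiset.map_cons, Multiset.sum_cons,
        Finsupp.prod_add_index' (fun _ => pow_zero _) (fun _ _ _ => pow_add _ _ _)]
      ring
  have hpow : ∀ (x : ℂ) (U : Multiset (Fin m)),
      (U.map fun i => x ^ d i).prod = x ^ (U.map d).sum := by
    intro x U
    induction U using Multiset.induction_on with
    | empty => simp
    | cons a U ih => rw [Multiset.map_cons, Multiset.prod_cons, ih, Multiset.map_cons,
        Multiset.sum_cons, pow_add]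
  have heval : ∀ (x : ℂ) (y : Fin s → ℂ), (∀ i, c i * (e i).prod (fun n k => y n ^ k) = x ^ d i) →
      ∀ U : Multiset (Fin m), (U.map c).prod * (U.map e).sum.prod (fun n k => y n ^ k) =
        x ^ (U.map d).sum := by
    intro x y hy U
    rw [← hmono, ← hpow]
    congr 1
    exact Multiset.map_congr rfl fun i _ => hy i
  obtain ⟨y₁, hy₁⟩ := hsw 1
  obtain ⟨y₂, hy₂⟩ := hsw 2
  have hc : (S.map c).prod = (T.map c).prod := by
    have a := heval 1 y₁ hy₁ S
    have b := heval 1 y₁ hy₁ T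
    rw [one_pow, h] at a
    rw [one_pow] at b
    calc (S.map c).prod
        = (S.map c).prod * ((T.map c).prod * (T.map e).sum.prod (fun n k => y₁ n ^ k)) := by
          rw [b, mul_one]
      _ = (T.map c).prod * ((S.map c).prod * (T.map e).sum.prod (fun n k => y₁ n ^ k)) := by ring
      _ = (T.map c).prod := by rw [a, mul_one]
  have h2 : (2 : ℂ) ^ (S.map d).sum = 2 ^ (T.map d).sum := by
    rw [← heval 2 y₂ hy₂ S, ← heval 2 y₂ hy₂ T, h, hc]
  have h2' : ((2 ^ (S.map d).sum : ℕ) : ℂ) = ((2 ^ (T.map d).sum : ℕ) : ℂ) := by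
    push_cast
    exact h2
  exact Nat.pow_right_injective le_rfl (Nat.cast_injective h2')

/-- **Arithmetic.** For `m > 6^10` and `s^10 ≤ m^9` there is `q` with `s < q^30` and
`(q + 4)·s < m` (take `q` least with `s < q^30`). [folklore] -/
theorem exists_root_param {m s : ℕ} (hm : 6 ^ 10 + 1 ≤ m) (hs : s ^ 10 ≤ m ^ 9) :
    ∃ q : ℕ, s < q ^ 30 ∧ (q + 4) * s < m := by
  have hex : ∃ q, s < q ^ 30 :=
    ⟨s + 1, (Nat.lt_succ_self s).trans_le (Nat.le_self_pow (by norm_num) _)⟩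
  obtain ⟨p, hp⟩ : ∃ p, Nat.find hex = p + 1 := by
    refine Nat.exists_eq_add_one_of_ne_zero fun h => ?_
    have := Nat.find_spec hex
    rw [h] at this
    simp at this
  have hq : s < (p + 1) ^ 30 := hp ▸ Nat.find_spec hex
  have hps : p ^ 30 ≤ s := not_lt.1 (Nat.find_min hex (by omega : p < Nat.find hex))
  refine ⟨p + 1, hq, ?_⟩
  -- `(p + 5)^10 < m`
  have key : (p + 5) ^ 10 < m := by
    rcases Nat.lt_or_ge p 2 with hp2 | hp2
    · calc (p + 5) ^ 10 ≤ 6 ^ 10 := Nat.pow_le_pow_left (by omega) _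
        _ < m := hm
    · have h1 : p ^ 300 ≤ m ^ 9 :=
        calc p ^ 300 = (p ^ 30) ^ 10 := by rw [← pow_mul]
          _ ≤ s ^ 10 := Nat.pow_le_pow_left hps _
          _ ≤ m ^ 9 := hs
      have h2 : p ^ 100 ≤ m ^ 3 :=
        (Nat.pow_le_pow_iff_left (by norm_num : (3 : ℕ) ≠ 0)).1 <|
          calc (p ^ 100) ^ 3 = p ^ 300 := by rw [← pow_mul]
            _ ≤ m ^ 9 := h1
            _ = (m ^ 3) ^ 3 := by rw [← pow_mul]
      have hp3 : p + 5 ≤ p ^ 3 := by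
        have h4 : 4 ≤ p * p := Nat.mul_le_mul hp2 hp2
        have h5 : 4 * p ≤ p * p * p := Nat.mul_le_mul_right p h4
        calc p + 5 ≤ 4 * p := by omega
          _ ≤ p * p * p := h5
          _ = p ^ 3 := by ring
      have h3 : (p + 5) ^ 30 < m ^ 3 :=
        calc (p + 5) ^ 30 ≤ (p ^ 3) ^ 30 := Nat.pow_le_pow_left hp3 _
          _ = p ^ 90 := by rw [← pow_mul]
          _ < p ^ 100 := Nat.pow_lt_pow_right (by omega) (by norm_num)
          _ ≤ m ^ 3 := h2
      exact (Nat.pow_lt_pow_iff_left (by norm_num : (3 : ℕ) ≠ 0)).1 <|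
        calc ((p + 5) ^ 10) ^ 3 = (p + 5) ^ 30 := by rw [← pow_mul]
          _ < m ^ 3 := h3
  -- `((p + 5)·s)^10 < m^10`
  have hm0 : 0 < m := by omega
  exact (Nat.pow_lt_pow_iff_left (by norm_num : (10 : ℕ) ≠ 0)).1 <|
    calc ((p + 1 + 4) * s) ^ 10 = (p + 5) ^ 10 * s ^ 10 := by ring
      _ ≤ (p + 5) ^ 10 * m ^ 9 := Nat.mul_le_mul_left _ hs
      _ < m * m ^ 9 := Nat.mul_lt_mul_of_lt_of_le key le_rfl (by positivity)
      _ = m ^ 10 := by ring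

end GirthSidonToric

open GirthSidonToric in
/-- **Item `stmt-ValiantsHypothesis-6538` (route GirthSidon, support `ToricSwallowForcesShortRelation`).**
For `m ≥ 6^10 + 1`, `s^10 ≤ m^9`, every `d : Fin m → ℕ` and every map `Γ : ℂ^s → ℂ^m` whose
coordinates are monomials of degree `≤ 2`: if the curve `x ↦ (x^{d_i})_i` lies in the image of `Γ`
pointwise, then there are multisets `S ≠ T` over `Fin m` of sizes `≤ 30` with `Σ_S d = Σ_T d`.
Toric half of the swallowing crux (transfer at `x = 1, 2`; loops/singletons; minimum-degree core;
relation-valued Moore bound). [folklore] -/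
theorem toricSwallowForcesShortRelation_proof :
    Summit.ValiantsHypothesis.ValiantsHypothesis.Theses.GirthSidon.ToricSwallowForcesShortRelation := by
  refine ⟨6 ^ 10 + 1, fun m hm d s hs Γ hdeg hmono hsub => ?_⟩
  classical
  choose e c hΓ using hmono
  -- pointwise swallowing, coordinatewise
  have hsw : ∀ x : ℂ, ∃ y : Fin s → ℂ, ∀ i, c i * (e i).prod (fun n k => y n ^ k) = x ^ d i := by
    intro x
    obtain ⟨y, hy⟩ := hsub (Set.mem_range_self (fun _ : Fin 1 => x))
    refine ⟨y, fun i => ?_⟩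
    have := congrFun hy i
    simpa [Literature.Computability.AlgebraicComplexity.polyMapEval_apply, hΓ,
      MvPolynomial.eval_monomial] using this
  -- a constant coordinate forces `d i = 0`, a relation of length one
  by_cases he0 : ∃ i, e i = 0
  · obtain ⟨i, hi⟩ := he0
    obtain ⟨y₀, hy₀⟩ := hsw 0
    obtain ⟨y₁, hy₁⟩ := hsw 1
    have h0 := hy₀ i
    have h1 := hy₁ i
    rw [hi, Finsupp.prod_zero_index, mul_one] at h0 h1
    rw [one_pow] at h1
    rw [h1] at h0
    have hdi : d i = 0 := by
      by_contra hne
      rw [zero_pow hne] at h0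
      exact one_ne_zero h0
    exact ⟨{i}, 0, by simp, by simp, by simp, by simp [hdi]⟩
  push Not at he0
  have hc : ∀ i, c i ≠ 0 := by
    intro i hci
    obtain ⟨y₁, hy₁⟩ := hsw 1
    have := hy₁ i
    rw [hci, zero_mul, one_pow] at this
    exact zero_ne_one this
  -- endpoint multisets
  have hcard : ∀ i, Multiset.card (Finsupp.toMultiset (e i)) ≤ 2 := by
    intro i
    have := hdeg i
    rw [hΓ, MvPolynomial.totalDegree_monomial _ (hc i)] at this
    rw [Finsupp.card_toMultiset]
    exact this
  have hne : ∀ i, Finsupp.toMultiset (e i) ≠ 0 := by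
    intro i h
    apply he0 i
    rw [← Finsupp.toMultiset_toFinsupp (e i), h]
    simp
  obtain ⟨q, hq, hqm⟩ := exists_root_param hm hs
  obtain ⟨S, T, hST, hS, hT, hsum⟩ := exists_short_relation (fun i => Finsupp.toMultiset (e i))
    hne hcard (q := q) (by simpa using hq) (by simpa using hqm)
  refine ⟨S, T, hST, hS, hT, sum_map_eq_of_swallow d e c hsw ?_⟩
  have hmap := congrArg Multiset.toFinsupp hsum
  rwa [← Function.comp_def Finsupp.toMultiset e, ← Multiset.map_map, ← Multiset.map_map,
    ← map_multiset_sum, ← map_multiset_sum, Finsupp.toMultiset_toFinsupp,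
    Finsupp.toMultiset_toFinsupp] at hmap

end Summit.ValiantsHypothesis.ValiantsHypothesis.Theorems
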